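import Summits.RiemannHypothesis.RiemannHypothesis.Theses.WeilParity
import Summits.RiemannHypothesis.RiemannHypothesis.Theorems.WeilParityEvenWinsArch
import Literature.NumberTheory.LFunctions.WeilSmallSupportPositivity
import Literature.NumberTheory.LFunctions.ZetaArgVariation

/-!
# `OffLineParityDetection` (crux stmt-RiemannHypothesis-15431, route WeilParity) — load-bearing analysis

Negative lemmas from the standing disprover (refuter-cdisprove-stmt-RiemannHypothesis-15431-0, cycle 1).
The crux is `C := ∀ ρ, ζ ρ = 0 → 0 < Re ρ → Re ρ < 1 → Re ρ ≠ 1/2 → Concl` with a `ρ`-FREE conclusion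
`Concl` ("at some window some odd normalised Weil test undercuts every even normalised Weil test by a
margin"; `Concl ↔ ¬ EvenSectorWins`, the route target, is recorded in the refuter's Negative/Calibration
file p151092 and not repeated here).  All statements below are INLINED variants of the crux signature
(no new definitions):

* `offLineParityDetection_withoutZero_iff_concl`, `…_withoutRePos_iff_concl`,
  `…_withoutNeHalf_iff_concl`: deleting `ζ ρ = 0` (witness `ρ = 1/4`), `0 < Re ρ` (trivial zero
  `-2`) or `Re ρ ≠ 1/2` (the tree's critical-strip zero `σ + iγ₀`, `exists_zero_of_zetaOrdinate_holds`)
  turns the crux into its bare conclusion, i.e. into the negation of the route's own target — these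
  binders are load-bearing;
* `offLineParityDetection_withoutReLtOne_of`: the binder `Re ρ < 1` is REDUNDANT — the crux already
  implies its variant without that binder (`riemannZeta_ne_zero_of_one_le_re`; the converse is trivial);
* `offLineParityDetection_withoutOddNorm`: deleting the odd witness's normalisation `∫‖o‖² = 1` makes
  the statement a THEOREM (witness `o = 0`, Bombieri 2000 Thm 12 coercivity `weilQuadratic_coercive`) —
  the normalisation is what makes the crux non-trivial;
* `oddWinsEverywhere_iff_not_exists_offLine`: the strengthening "odd wins at EVERY window `a > 0`"
  holds iff there is no off-line zero at all, by the landed prime-free parity theorem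
  `evenWinsArch_proof` (item 15433); `log_two_div_two_lt_of_oddWinsAt`: a detecting window is
  necessarily `> (log 2)/2`.

Axioms: propext, Classical.choice, Quot.sound.
-/

noncomputable section

namespace Summit.RiemannHypothesis.RiemannHypothesis.Theorems.WeilParity.OffLineParityDetection.Negative

-- `Summit.RiemannHypothesis.RiemannHypothesis.…` repeats a namespace component by design (D-0017 layout).
set_option linter.dupNamespace false

open Set MeasureTheory Complex
open Literature.NumberTheory.LFunctions
open Summit.RiemannHypothesis.RiemannHypothesis.Theses.WeilParity

/-- **`ζ ρ = 0` is load-bearing**: with it deleted, the crux is equivalent to its bare (ρ-free)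
conclusion (witness `ρ = 1/4` for the remaining binders). [folklore] -/
theorem offLineParityDetection_withoutZero_iff_concl :
    (∀ ρ : ℂ, 0 < ρ.re → ρ.re < 1 → ρ.re ≠ 1 / 2 →
      ∃ a : ℝ, 0 < a ∧ ∃ o : ℝ → ℂ, IsWeilTest o ∧ tsupport o ⊆ Set.Icc (-a) a ∧
        (∀ t, o (-t) = -o t) ∧ ∫ t, ‖o t‖ ^ 2 = (1 : ℝ) ∧ ∃ m : ℝ, 0 < m ∧
          ∀ e : ℝ → ℂ, IsWeilTest e → tsupport e ⊆ Set.Icc (-a) a → (∀ t, e (-t) = e t) →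
            ∫ t, ‖e t‖ ^ 2 = (1 : ℝ) → (weilQuadratic o).re + m ≤ (weilQuadratic e).re) ↔
    (∃ a : ℝ, 0 < a ∧ ∃ o : ℝ → ℂ, IsWeilTest o ∧ tsupport o ⊆ Set.Icc (-a) a ∧
        (∀ t, o (-t) = -o t) ∧ ∫ t, ‖o t‖ ^ 2 = (1 : ℝ) ∧ ∃ m : ℝ, 0 < m ∧
          ∀ e : ℝ → ℂ, IsWeilTest e → tsupport e ⊆ Set.Icc (-a) a → (∀ t, e (-t) = e t) →
            ∫ t, ‖e t‖ ^ 2 = (1 : ℝ) → (weilQuadratic o).re + m ≤ (weilQuadratic e).re) :=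
  ⟨fun h ↦ h (1 / 4) (by norm_num) (by norm_num) (by norm_num), fun h _ _ _ _ ↦ h⟩

/-- **`0 < Re ρ` is load-bearing**: with it deleted, the trivial zero `ρ = -2`
(`riemannZeta_neg_two_mul_nat_add_one 0`) discharges the antecedent, so the crux is equivalent to
its bare conclusion. [folklore] -/
theorem offLineParityDetection_withoutRePos_iff_concl :
    (∀ ρ : ℂ, riemannZeta ρ = 0 → ρ.re < 1 → ρ.re ≠ 1 / 2 →
      ∃ a : ℝ, 0 < a ∧ ∃ o : ℝ → ℂ, IsWeilTest o ∧ tsupport o ⊆ Set.Icc (-a) a ∧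
        (∀ t, o (-t) = -o t) ∧ ∫ t, ‖o t‖ ^ 2 = (1 : ℝ) ∧ ∃ m : ℝ, 0 < m ∧
          ∀ e : ℝ → ℂ, IsWeilTest e → tsupport e ⊆ Set.Icc (-a) a → (∀ t, e (-t) = e t) →
            ∫ t, ‖e t‖ ^ 2 = (1 : ℝ) → (weilQuadratic o).re + m ≤ (weilQuadratic e).re) ↔
    (∃ a : ℝ, 0 < a ∧ ∃ o : ℝ → ℂ, IsWeilTest o ∧ tsupport o ⊆ Set.Icc (-a) a ∧
        (∀ t, o (-t) = -o t) ∧ ∫ t, ‖o t‖ ^ 2 = (1 : ℝ) ∧ ∃ m : ℝ, 0 < m ∧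
          ∀ e : ℝ → ℂ, IsWeilTest e → tsupport e ⊆ Set.Icc (-a) a → (∀ t, e (-t) = e t) →
            ∫ t, ‖e t‖ ^ 2 = (1 : ℝ) → (weilQuadratic o).re + m ≤ (weilQuadratic e).re) := by
  refine ⟨fun h ↦ ?_, fun h _ _ _ _ ↦ h⟩
  have hz : riemannZeta (-2 * ((0 : ℕ) + 1)) = 0 := riemannZeta_neg_two_mul_nat_add_one 0
  exact h _ hz (by norm_num) (by norm_num)

/-- **`Re ρ ≠ 1/2` is load-bearing**: with it deleted, the tree's zero `σ + iγ₀` in the open strip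
(`exists_zero_of_zetaOrdinate_holds 0`, Riemann–von Mangoldt) discharges the antecedent, so the crux
is equivalent to its bare conclusion. [folklore] -/
theorem offLineParityDetection_withoutNeHalf_iff_concl :
    (∀ ρ : ℂ, riemannZeta ρ = 0 → 0 < ρ.re → ρ.re < 1 →
      ∃ a : ℝ, 0 < a ∧ ∃ o : ℝ → ℂ, IsWeilTest o ∧ tsupport o ⊆ Set.Icc (-a) a ∧
        (∀ t, o (-t) = -o t) ∧ ∫ t, ‖o t‖ ^ 2 = (1 : ℝ) ∧ ∃ m : ℝ, 0 < m ∧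
          ∀ e : ℝ → ℂ, IsWeilTest e → tsupport e ⊆ Set.Icc (-a) a → (∀ t, e (-t) = e t) →
            ∫ t, ‖e t‖ ^ 2 = (1 : ℝ) → (weilQuadratic o).re + m ≤ (weilQuadratic e).re) ↔
    (∃ a : ℝ, 0 < a ∧ ∃ o : ℝ → ℂ, IsWeilTest o ∧ tsupport o ⊆ Set.Icc (-a) a ∧
        (∀ t, o (-t) = -o t) ∧ ∫ t, ‖o t‖ ^ 2 = (1 : ℝ) ∧ ∃ m : ℝ, 0 < m ∧
          ∀ e : ℝ → ℂ, IsWeilTest e → tsupport e ⊆ Set.Icc (-a) a → (∀ t, e (-t) = e t) →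
            ∫ t, ‖e t‖ ^ 2 = (1 : ℝ) → (weilQuadratic o).re + m ≤ (weilQuadratic e).re) := by
  refine ⟨fun h ↦ ?_, fun h _ _ _ _ ↦ h⟩
  obtain ⟨σ, hσ0, hσ1, hz⟩ := exists_zero_of_zetaOrdinate_holds 0
  exact h _ hz (by simp [hσ0]) (by simp [hσ1])

/-- **`Re ρ < 1` is REDUNDANT**: the crux implies its variant with `Re ρ < 1` deleted (the converse
direction is trivial),
because `ζ` has no zeros with `Re ρ ≥ 1` (`riemannZeta_ne_zero_of_one_le_re`). [folklore] -/
theorem offLineParityDetection_withoutReLtOne_of (h : OffLineParityDetection) :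
    ∀ ρ : ℂ, riemannZeta ρ = 0 → 0 < ρ.re → ρ.re ≠ 1 / 2 →
      ∃ a : ℝ, 0 < a ∧ ∃ o : ℝ → ℂ, IsWeilTest o ∧ tsupport o ⊆ Set.Icc (-a) a ∧
        (∀ t, o (-t) = -o t) ∧ ∫ t, ‖o t‖ ^ 2 = (1 : ℝ) ∧ ∃ m : ℝ, 0 < m ∧
          ∀ e : ℝ → ℂ, IsWeilTest e → tsupport e ⊆ Set.Icc (-a) a → (∀ t, e (-t) = e t) →
            ∫ t, ‖e t‖ ^ 2 = (1 : ℝ) → (weilQuadratic o).re + m ≤ (weilQuadratic e).re := by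
  intro ρ hζ h0 hne
  refine h ρ hζ h0 ?_ hne
  by_contra h1
  exact riemannZeta_ne_zero_of_one_le_re (not_lt.1 h1) hζ

/-- **The odd normalisation is what makes the crux non-trivial**: with `∫‖o‖² = 1` deleted the
statement is a THEOREM, unconditionally and without using the zero — witness `o = 0` and a small
window on which Weil's form is coercive, `Re Q(e) ≥ (Re Q(0) + 1)‖e‖²` (Bombieri 2000 Thm 12,
`weilQuadratic_coercive`). [cite: Bombieri2000Weil, §12 Thm. 12] -/
theorem offLineParityDetection_withoutOddNorm :
    ∀ ρ : ℂ, riemannZeta ρ = 0 → 0 < ρ.re → ρ.re < 1 → ρ.re ≠ 1 / 2 →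
      ∃ a : ℝ, 0 < a ∧ ∃ o : ℝ → ℂ, IsWeilTest o ∧ tsupport o ⊆ Set.Icc (-a) a ∧
        (∀ t, o (-t) = -o t) ∧ ∃ m : ℝ, 0 < m ∧
          ∀ e : ℝ → ℂ, IsWeilTest e → tsupport e ⊆ Set.Icc (-a) a → (∀ t, e (-t) = e t) →
            ∫ t, ‖e t‖ ^ 2 = (1 : ℝ) → (weilQuadratic o).re + m ≤ (weilQuadratic e).re := by
  intro ρ _ _ _ _
  obtain ⟨a₀, ha₀, hco⟩ := weilQuadratic_coercive ((weilQuadratic (0 : ℝ → ℂ)).re + 1)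
  refine ⟨a₀, ha₀, 0, ⟨contDiff_zero_fun, HasCompactSupport.zero⟩, ?_, fun t ↦ by simp, 1,
    one_pos, ?_⟩
  · rw [tsupport_eq_empty_iff.2 rfl]
    exact Set.empty_subset _
  · intro e he hes _ hen
    have h := hco a₀ ha₀ le_rfl e he hes
    rw [hen, mul_one] at h
    exact h

/-- The landed prime-free parity theorem (`evenWinsArch_proof`, item stmt-RiemannHypothesis-15433)
forbids a strict odd win on any window `0 < a ≤ (log 2)/2`: **a detecting window is necessarily
`> (log 2)/2`** (primes must enter the form). [folklore] -/
theorem log_two_div_two_lt_of_oddWinsAt {a : ℝ} (ha : 0 < a)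
    (h : ∃ o : ℝ → ℂ, IsWeilTest o ∧ tsupport o ⊆ Set.Icc (-a) a ∧
      (∀ t, o (-t) = -o t) ∧ ∫ t, ‖o t‖ ^ 2 = (1 : ℝ) ∧ ∃ m : ℝ, 0 < m ∧
        ∀ e : ℝ → ℂ, IsWeilTest e → tsupport e ⊆ Set.Icc (-a) a → (∀ t, e (-t) = e t) →
          ∫ t, ‖e t‖ ^ 2 = (1 : ℝ) → (weilQuadratic o).re + m ≤ (weilQuadratic e).re) :
    Real.log 2 / 2 < a := by
  by_contra hle
  obtain ⟨o, ho, hos, hodd, hon, m, hm, hdet⟩ := h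
  obtain ⟨e, he, hes, hev, hen, hle'⟩ :=
    Theorems.WeilParity.evenWinsArch_proof a ha (not_lt.1 hle) o ho hos hodd hon (m / 2)
      (by linarith)
  have := hdet e he hes hev hen
  linarith

/-- **The uniform-in-window strengthening collapses to RH**: "for every off-line zero the odd sector
strictly wins at EVERY window `a > 0`" holds iff there is no off-line zero at all — so in any proof
of the crux the detecting window must depend on the zero configuration. [folklore] -/
theorem oddWinsEverywhere_iff_not_exists_offLine :
    (∀ ρ : ℂ, riemannZeta ρ = 0 → 0 < ρ.re → ρ.re < 1 → ρ.re ≠ 1 / 2 → ∀ a : ℝ, 0 < a →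
      ∃ o : ℝ → ℂ, IsWeilTest o ∧ tsupport o ⊆ Set.Icc (-a) a ∧
        (∀ t, o (-t) = -o t) ∧ ∫ t, ‖o t‖ ^ 2 = (1 : ℝ) ∧ ∃ m : ℝ, 0 < m ∧
          ∀ e : ℝ → ℂ, IsWeilTest e → tsupport e ⊆ Set.Icc (-a) a → (∀ t, e (-t) = e t) →
            ∫ t, ‖e t‖ ^ 2 = (1 : ℝ) → (weilQuadratic o).re + m ≤ (weilQuadratic e).re) ↔
    ¬ ∃ ρ : ℂ, riemannZeta ρ = 0 ∧ 0 < ρ.re ∧ ρ.re < 1 ∧ ρ.re ≠ 1 / 2 := by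
  constructor
  · rintro h ⟨ρ, hζ, h0, h1, hne⟩
    have hlog : (0 : ℝ) < Real.log 2 / 2 := by
      have := Real.log_two_gt_d9
      linarith
    exact lt_irrefl _ (log_two_div_two_lt_of_oddWinsAt hlog (h ρ hζ h0 h1 hne _ hlog))
  · intro h ρ hζ h0 h1 hne
    exact absurd ⟨ρ, hζ, h0, h1, hne⟩ h

end Summit.RiemannHypothesis.RiemannHypothesis.Theorems.WeilParity.OffLineParityDetection.Negative

end
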